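import Summits.KontsevichZagierPeriods.KontsevichZagierPeriods.Theses.TerasomaMultiplication
import Summits.KontsevichZagierPeriods.KontsevichZagierPeriods.Theorems.MultiplicationAccessible.Negative.Core
import Summits.KontsevichZagierPeriods.KontsevichZagierPeriods.Theorems.TerasomaMultiplicationMultiplicationAccessibleStubStripBridge
import Summits.KontsevichZagierPeriods.KontsevichZagierPeriods.Theorems.TerasomaMultiplicationMultiplicationAccessibleStubDirichletSimplex
import Summits.KontsevichZagierPeriods.KontsevichZagierPeriods.Theorems.TerasomaMultiplicationMultiplicationAccessibleCornerGlue
import Summits.KontsevichZagierPeriods.KontsevichZagierPeriods.Theorems.TerasomaMultiplicationMultiplicationAccessibleTranslateX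
import Summits.KontsevichZagierPeriods.KontsevichZagierPeriods.Theorems.TerasomaMultiplicationMultiplicationAccessibleTranslateSGen
import Summits.KontsevichZagierPeriods.KontsevichZagierPeriods.Theorems.TerasomaMultiplicationMultiplicationAccessibleBlowupChartGen
import Summits.KontsevichZagierPeriods.KontsevichZagierPeriods.Theorems.TerasomaMultiplicationMultiplicationAccessibleRotationAverageGen
import Summits.KontsevichZagierPeriods.KontsevichZagierPeriods.Theorems.TerasomaMultiplicationMultiplicationAccessibleCornerStokesGen
import Literature.NumberTheory.Transcendental.KZProductIdeal

/-!
# `MultiplicationAccessible` (stmt-KontsevichZagierPeriods-12305, route TerasomaMultiplication) — PROVED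

The crux: for every `m ≥ 1` (`n = m + 1`) and rational `s > 0`, the box representation of
`∏_{k=1}^{m} B(k/n, s)` on `(0,1)^m` and the simplex representation
`[{σ > 0, Σσ < n}, (∏σⱼ·(n − Σσⱼ))^(s−1)]` of `n^(ns−1)Γ(s)^n/Γ(ns)` are equivalent in the
Kontsevich–Zagier calculus of moves (the period statement of Gauss's multiplication formula INSIDE the
rules, uniformly in `n`).

Line `shifted-family-prime-sieve` via the Liouville rotation flow (leads 0–c3): the shifted family
`GM(m; x, s) : ∏_{k<n} B(x + k/n, s) ∼ n^(ns) B(nx, ns) ∏_{j<m} B((j+1)s, s)` is proved for EVERY `m`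
and all rational `x, s > 0` (`gm_all`) by ONE Stokes in dimension `n + 1`: rotation average and
corner blow-up chart (`rotationAverageGen`, `blowupChartGen`), the Stokes core on the chart domain
(`stokes_core_gen`: lateral and exceptional-face Newton–Leibniz moves + the `v`-move + closedness), the
relabelled Beta × Dirichlet face (`cornerGen`), the corner glue `gm_of_corner_at` and the Beta
translations `gm_of_gm_succ_x/s` (reduction to `x ≥ 2`, `s ≥ 3`). At `x = 1/n` the landed bridge
(`stub_stripBridge`: two Newton–Leibniz strips + rescaling; `stub_dirichletSimplex`: the Dirichlet
chart) converts `GM` into the crux pair (`MultiplicationAccessible_of`).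
References: Kontsevich–Zagier 2001 §1.2; Andrews–Askey–Roy 1999 Thm 1.5.2 (Gauss), Thm 1.8.1
(Dirichlet); Liouville 1855 (the rotation-flow proof of the multiplication formula).
-/

noncomputable section

open MeasureTheory Set Real Finset
open scoped BigOperators Topology
open Literature.NumberTheory.Transcendental
open Literature.NumberTheory.Transcendental.KZ
open Summit.KontsevichZagierPeriods.KontsevichZagierPeriods.Theses.TerasomaMultiplication
  (MultiplicationAccessible)
open Summit.KontsevichZagierPeriods.MultiplicationAccessible.Negative (multiplicationAccessible_iff)

namespace Summit.KontsevichZagierPeriods.TerasomaMultiplication.MultiplicationAccessible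

/-- Relabelling of the Beta × Dirichlet representation to the order `(θ₁, …, θ_{n+1}, v)`: domain. [folklore] -/
theorem CornerGen.reindex_domain_eq {n : ℕ} (r' : IntegralRep (n + 1 + 1))
    (hr'd : r'.domain = {w | w 0 ∈ Set.Ioo (0:ℝ) 1 ∧ (∀ i : Fin (n + 1), 0 < w i.succ) ∧ ∑ i : Fin (n + 1), w i.succ < 1}) :
    (r'.reindex (finRotate (n + 2)).symm).domain = {q : Fin (n + 2) → ℝ | (∀ i : Fin (n + 1), 0 < q (Fin.castSucc i)) ∧ ∑ i : Fin (n + 1), q (Fin.castSucc i) < 1 ∧ 0 < q (Fin.last (n + 1)) ∧ q (Fin.last (n + 1)) < 1} := by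
  have he0 : (finRotate (n + 2)).symm 0 = Fin.last (n + 1) := (Equiv.symm_apply_eq _).mpr finRotate_last.symm
  have hes : ∀ i : Fin (n + 1), (finRotate (n + 2)).symm i.succ = Fin.castSucc i := by
    intro i
    rw [Equiv.symm_apply_eq]
    exact Fin.ext (by rw [coe_finRotate_of_ne_last (Fin.castSucc_lt_last i).ne]; simp)
  ext q
  simp only [IntegralRep.reindex_domain, hr'd, mem_setOf_eq, he0, hes, Set.mem_Ioo]
  tauto

/-- Relabelling of the Beta × Dirichlet representation: integrand = the exceptional-face density
`p·v^(px−1)(1−v)^(ps−1)·p^(ps−1)·(θ₀θ₁⋯θ_{n+1})^(s−1)`. [folklore] -/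
theorem CornerGen.reindex_integrand_eqOn {n : ℕ} (x s : ℚ) (r' : IntegralRep (n + 1 + 1))
    (hr'd : r'.domain = {w | w 0 ∈ Set.Ioo (0:ℝ) 1 ∧ (∀ i : Fin (n + 1), 0 < w i.succ) ∧ ∑ i : Fin (n + 1), w i.succ < 1})
    (hr'i : Set.EqOn r'.integrand (fun w => (((n + 1 : ℕ):ℝ) + 1) * ((w 0) ^ ((((n + 1 : ℕ):ℝ) + 1) * (x:ℝ) - 1) *
      (1 - w 0) ^ ((((n + 1 : ℕ):ℝ) + 1) * (s:ℝ) - 1)) * ((((n + 1 : ℕ):ℝ) + 1) ^ ((((n + 1 : ℕ):ℝ) + 1) * (s:ℝ) - 1) *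
      ((∏ i : Fin (n + 1), (w i.succ) ^ ((s:ℝ) - 1)) * (1 - ∑ i : Fin (n + 1), w i.succ) ^ ((s:ℝ) - 1)))) r'.domain) :
    Set.EqOn (r'.reindex (finRotate (n + 2)).symm).integrand (fun q => (((n:ℝ) + 2) * (q (Fin.last (n + 1))) ^ (((n:ℝ) + 2) * (x:ℝ) - 1) * (1 - q (Fin.last (n + 1))) ^ (((n:ℝ) + 2) * (s:ℝ) - 1)) *
      (((n:ℝ) + 2) ^ (((n:ℝ) + 2) * (s:ℝ) - 1) * ((1 - ∑ i : Fin (n + 1), q (Fin.castSucc i)) * ∏ i : Fin (n + 1), q (Fin.castSucc i)) ^ ((s:ℝ) - 1))) (r'.reindex (finRotate (n + 2)).symm).domain := by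
  have he0 : (finRotate (n + 2)).symm 0 = Fin.last (n + 1) := (Equiv.symm_apply_eq _).mpr finRotate_last.symm
  have hes : ∀ i : Fin (n + 1), (finRotate (n + 2)).symm i.succ = Fin.castSucc i := by
    intro i
    rw [Equiv.symm_apply_eq]
    exact Fin.ext (by rw [coe_finRotate_of_ne_last (Fin.castSucc_lt_last i).ne]; simp)
  intro q hq
  have hq' : (fun i => q ((finRotate (n + 2)).symm i)) ∈ r'.domain := hq
  have hpos : (∀ i : Fin (n + 1), 0 < q (Fin.castSucc i)) ∧ ∑ i : Fin (n + 1), q (Fin.castSucc i) < 1 := by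
    rw [hr'd] at hq'
    simp only [mem_setOf_eq, hes] at hq'
    exact ⟨hq'.2.1, hq'.2.2⟩
  simp only [IntegralRep.reindex_integrand]
  rw [hr'i hq']
  simp only [he0, hes]
  have hP : (((n + 1 : ℕ):ℝ) + 1) = ((n:ℝ) + 2) := by push_cast; ring
  rw [hP, Real.mul_rpow (by linarith [hpos.2]) (Finset.prod_nonneg fun i _ => (hpos.1 i).le),
    Real.finsetProd_rpow _ _ (fun i _ => (hpos.1 i).le)]
  ring_nf

/-- **`(♣)_p` for `x ≥ 2`, `s ≥ 3`** (`p = n + 2`): the shifted `p`-fold Beta product is equivalent to the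
corner (Beta × Dirichlet) representation — rotation average, blow-up chart, the Stokes core, relabelling.
[cite: KontsevichZagier2001, §1.2] -/
theorem cornerGen : ∀ (n : ℕ) (x s : ℚ), 2 ≤ x → 3 ≤ s → ∀ (r r' : KZ.IntegralRep (n + 1 + 1)), r.domain = {z | ∀ i, z i ∈ Set.Ioo (0:ℝ) 1} → Set.EqOn r.integrand (fun z => ∏ k : Fin (n + 1 + 1), (z k) ^ ((x:ℝ) + ((k:ℕ):ℝ) / (((n + 1 : ℕ):ℝ) + 1) - 1) * (1 - z k) ^ ((s:ℝ) - 1)) r.domain → r'.domain = {w | w 0 ∈ Set.Ioo (0:ℝ) 1 ∧ (∀ i : Fin (n + 1), 0 < w i.succ) ∧ ∑ i : Fin (n + 1), w i.succ < 1} → Set.EqOn r'.integrand (fun w => (((n + 1 : ℕ):ℝ) + 1) * ((w 0) ^ ((((n + 1 : ℕ):ℝ) + 1) * (x:ℝ) - 1) * (1 - w 0) ^ ((((n + 1 : ℕ):ℝ) + 1) * (s:ℝ) - 1)) * ((((n + 1 : ℕ):ℝ) + 1) ^ ((((n + 1 : ℕ):ℝ) + 1) * (s:ℝ) - 1) * ((∏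 i : Fin (n + 1), (w i.succ) ^ ((s:ℝ) - 1)) * (1 - ∑ i : Fin (n + 1), w i.succ) ^ ((s:ℝ) - 1)))) r'.domain → KZ.Equivalent r r' := by
  intro n x s hx hs r r' hrd hri hr'd hr'i
  have hx0 : (0:ℚ) < x := by linarith
  have hs0 : (0:ℚ) < s := by linarith
  -- the atoms, instantiated
  set Θ : (Fin (n + 2) → ℝ) → Fin (n + 2) → ℝ :=
    fun u k => Fin.cases (1 - ∑ i : Fin (n + 1), u (Fin.castSucc i)) (fun i => u (Fin.castSucc i)) k with hΘdef
  have hΘ0 : ∀ u, Θ u 0 = 1 - ∑ i : Fin (n + 1), u (Fin.castSucc i) := fun _ => rfl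
  have hΘs : ∀ u (i : Fin (n + 1)), Θ u i.succ = u (Fin.castSucc i) := fun _ _ => rfl
  set T : (Fin (n + 2) → ℝ) → Fin (n + 2) → ℝ := fun u k => 1 - u (Fin.last (n + 1)) * Θ u k with hTdef
  set Z : (Fin (n + 2) → ℝ) → ℝ := fun u => (∏ k, T u k) ^ (1 / ((n:ℝ) + 2)) with hZdef
  set S : (Fin (n + 2) → ℝ) → ℝ := fun u => ∑ j ∈ Finset.range (n + 2), (-1:ℝ) ^ j * u (Fin.last (n + 1)) ^ j *
      ∑ A ∈ Finset.powersetCard (j + 1) (Finset.univ : Finset (Fin (n + 2))), ∏ k ∈ A, Θ u k with hSdef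
  set H : (Fin (n + 2) → ℝ) → ℝ := fun u => (∑ j ∈ Finset.range (n + 2), Z u ^ j) / S u with hHdef
  set K : (Fin (n + 2) → ℝ) → ℝ := fun u => (∏ k, Θ u k) ^ ((s:ℝ) - 1) with hKdef
  set M : (Fin (n + 2) → ℝ) → Fin (n + 2) → ℝ := fun u k => (T u k) ^ (x:ℝ) *
      ∏ j : Fin (n + 1), (T u (k + j.succ)) ^ ((x:ℝ) + (((j:ℕ):ℝ) + 1) / ((n:ℝ) + 2) - 1) with hMdef
  set P : (Fin (n + 3) → ℝ) → ℝ := fun w => (w (Fin.last (n + 2))) ^ (((n:ℝ) + 2) * (x:ℝ) - 1) *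
      (1 - w (Fin.last (n + 2)) * Z (Fin.init w)) ^ (((n:ℝ) + 2) * (s:ℝ) - 1) * H (Fin.init w) ^ (((n:ℝ) + 2) * (s:ℝ)) *
      K (Fin.init w) with hPdef
  set G : (Fin (n + 2) → ℝ) → ℝ := fun t => (∑ j : Fin (n + 2), (∏ i ∈ Finset.univ.filter (fun i : Fin (n + 2) => i < j), t i) /
        ((∏ k, t k) ^ (1 / ((n:ℝ) + 2))) ^ (j:ℕ)) / ((n:ℝ) + 2) *
      ∏ k : Fin (n + 2), (t k) ^ ((x:ℝ) + ((k:ℕ):ℝ) / ((n:ℝ) + 2) - 1) * (1 - t k) ^ ((s:ℝ) - 1) with hGdef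
  have hG : (∀ t : Fin (n + 2) → ℝ, G t = (∑ j : Fin (n + 2), (∏ i ∈ Finset.univ.filter (fun i : Fin (n + 2) => i < j), t i) /
        ((∏ k, t k) ^ (1 / ((n:ℝ) + 2))) ^ (j:ℕ)) / ((n:ℝ) + 2) *
      ∏ k : Fin (n + 2), (t k) ^ ((x:ℝ) + ((k:ℕ):ℝ) / ((n:ℝ) + 2) - 1) * (1 - t k) ^ ((s:ℝ) - 1)) := fun _ => rfl
  obtain ⟨⟨r₀, hr₀d, hr₀i⟩, ⟨rU, hrUd, hrUi⟩, ⟨C, hC⟩⟩ :=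
    cornerGraphRepsGen n x s hx hs Θ T Z S H K M P hΘ0 hΘs (fun _ _ => rfl) (fun _ => rfl) (fun _ => rfl)
      (fun _ => rfl) (fun _ => rfl) (fun _ _ => rfl) (fun _ => rfl) G hG
  have hP' : (((n + 1 : ℕ):ℝ) + 1) = ((n:ℝ) + 2) := by push_cast; ring
  have hri' : Set.EqOn r.integrand
      (fun t => ∏ k : Fin (n + 2), (t k) ^ ((x:ℝ) + ((k:ℕ):ℝ) / ((n:ℝ) + 2) - 1) * (1 - t k) ^ ((s:ℝ) - 1)) r.domain := by
    intro t ht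
    rw [hri ht]
    simp only [hP']
  have e1 : Equivalent r r₀ :=
    rotationAverageGen n x s hx0 hs0 G hG r r₀ hrd hri' hr₀d (by rw [hr₀i]; exact fun _ _ => rfl)
  have e2 : Equivalent rU r₀ :=
    blowupChartGen n x s hx0 hs0 Θ T hΘ0 hΘs (fun _ _ => rfl) G hG rU r₀ hrUd (by rw [hrUi]; exact fun _ _ => rfl)
      hr₀d (by rw [hr₀i]; exact fun _ _ => rfl)
  set R := r'.reindex (finRotate (n + 2)).symm with hRdef
  have hRd := CornerGen.reindex_domain_eq r' hr'd
  have hRi := CornerGen.reindex_integrand_eqOn x s r' hr'd hr'i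
  have e3 : Equivalent rU R :=
    stokes_core_gen n x s hx hs Θ T Z S H K M P hΘ0 hΘs (fun _ _ => rfl) (fun _ => rfl) (fun _ => rfl)
      (fun _ => rfl) (fun _ => rfl) (fun _ _ => rfl) (fun _ => rfl) G hG C hC rU hrUd hrUi R hRd hRi
  have e4 : of r' - of R ∈ relations := of_sub_of_reindex_mem_relations r' (finRotate (n + 2)).symm
  show of r - of r' ∈ relations
  have : of r - of r' = (of r - of r₀) - (of rU - of r₀) + (of rU - of R) - (of r' - of R) := by abel
  rw [this]
  exact relations.sub_mem (relations.add_mem (relations.sub_mem e1 e2) e3) e4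

/-- `GM(n + 1; x, s)` for `x ≥ 2`, `s ≥ 3` (corner identity + `gm_of_corner_at`). [cite: KontsevichZagier2001, §1.2] -/
theorem gmGen_large : ∀ (n : ℕ) (x s : ℚ), 2 ≤ x → 3 ≤ s → ∀ (r r' : KZ.IntegralRep (n + 1 + 1)), r.domain = {z | ∀ i, z i ∈ Set.Ioo (0:ℝ) 1} → Set.EqOn r.integrand (fun z => ∏ k : Fin (n + 1 + 1), (z k) ^ ((x:ℝ) + ((k:ℕ):ℝ) / (((n + 1 : ℕ):ℝ) + 1) - 1) * (1 - z k) ^ ((s:ℝ) - 1)) r.domain → r'.domain = {z | ∀ i, z i ∈ Set.Ioo (0:ℝ) 1} → Set.EqOn r'.integrand (fun z => (((n + 1 : ℕ):ℝ) + 1) ^ ((((n + 1 : ℕ):ℝ) + 1) * (s:ℝ)) * ((z 0) ^ ((((n + 1 : ℕ):ℝ) + 1) * (x:ℝ) - 1) * (1 - z 0) ^ ((((n + 1 : ℕ):ℝ) + 1) * (s:ℝ) - 1)) * ∏ j : Fin (n + 1), (z j.succ) ^ ((((j:ℕ):ℝ) + 1) * (s:ℝ) - 1) * (1 - z j.succ)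 ^ ((s:ℝ) - 1)) r'.domain → KZ.Equivalent r r' := by
  intro n x s hx hs
  exact gm_of_corner_at (n + 1) x s (by linarith) (by linarith) (cornerGen n x s hx hs)

/-- **`GM(m; x, s)` for every `m ≥ 0` and all `x, s > 0`**: `m = 0` is an identity of integrands; for
`m = n + 1` reduce to `x ≥ 2`, `s ≥ 3` by the Beta translations (`gm_of_gm_succ_x` twice, `gm_of_gm_succ_s`
three times) and apply `gmGen_large`. [cite: KontsevichZagier2001, §1.2] -/
theorem gm_all : ∀ (m : ℕ) (x s : ℚ), 0 < x → 0 < s → ∀ (r r' : KZ.IntegralRep (m + 1)), r.domain = {z | ∀ i, z i ∈ Set.Ioo (0:ℝ) 1} → Set.EqOn r.integrand (fun z => ∏ k : Fin (m + 1), (z k) ^ ((x:ℝ) + ((k:ℕ):ℝ) / ((m:ℝ) + 1) - 1) * (1 - z k) ^ ((s:ℝ) - 1)) r.domain → r'.domain = {z | ∀ i, z i ∈ Set.Ioo (0:ℝ) 1} → Set.EqOn r'.integrand (fun z => ((m:ℝ) + 1) ^ (((m:ℝ) + 1) * (s:ℝ)) * ((z 0) ^ (((m:ℝ) + 1) * (x:ℝ)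 - 1) * (1 - z 0) ^ (((m:ℝ) + 1) * (s:ℝ) - 1)) * ∏ j : Fin m, (z j.succ) ^ ((((j:ℕ):ℝ) + 1) * (s:ℝ) - 1) * (1 - z j.succ) ^ ((s:ℝ) - 1)) r'.domain → KZ.Equivalent r r' := by
  intro m
  cases m with
  | zero =>
    intro x s _ _ r r' hrd hri hr'd hr'i
    refine of_sub_of_mem_relations_of_eqOn (hr'd.trans hrd.symm) fun z hz => ?_
    have hz' : z ∈ r'.domain := by rw [hr'd, ← hrd]; exact hz
    rw [hri hz, hr'i hz']
    simp only [Fin.prod_univ_succ, Fin.prod_univ_zero, Fin.val_zero, Nat.cast_zero, zero_div, add_zero,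
      zero_add, one_mul, mul_one, Real.one_rpow]
  | succ n =>
    intro x s hx hs
    have A := gmGen_large n (x + 1 + 1) (s + 1 + 1 + 1) (by linarith) (by linarith)
    have B := gm_of_gm_succ_s (n + 1) (x + 1 + 1) (s + 1 + 1) (by linarith) (by linarith) A
    have B' := gm_of_gm_succ_s (n + 1) (x + 1 + 1) (s + 1) (by linarith) (by linarith) B
    have B'' := gm_of_gm_succ_s (n + 1) (x + 1 + 1) s (by linarith) hs B'
    have D := gm_of_gm_succ_x (n + 1) (x + 1) s (by linarith) hs B''
    exact gm_of_gm_succ_x (n + 1) x s hx hs D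

/-! ## The crux from the line -/

/-- **The crux `MultiplicationAccessible`** (`Summit.…TerasomaMultiplication.MultiplicationAccessible`):
`GM m (1/n) s` for every `m` (`gm_all`), the strip/rescale bridge to the Beta box (`stub_stripBridge`, landed),
and the Dirichlet conversion of that box into the simplex representation (`stub_dirichletSimplex`, landed),
assembled through `Negative.multiplicationAccessible_iff`. [cite: KontsevichZagier2001, §1.2] -/
theorem MultiplicationAccessible_of : MultiplicationAccessible := by
  rw [multiplicationAccessible_iff]
  intro m s hm hs r r' hr hr'
  have hx : (0:ℚ) < 1 / ((m:ℚ) + 1) := by positivity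
  have hGM := gm_all m (1 / ((m:ℚ) + 1)) s hx hs
  obtain ⟨q, hqd, hqi, hrq⟩ := stub_stripBridge m s hm hs hGM r hr.1 hr.2
  exact hrq.trans (stub_dirichletSimplex m s hm hs q r' hqd hqi hr'.1 hr'.2)

end Summit.KontsevichZagierPeriods.TerasomaMultiplication.MultiplicationAccessible
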